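import Literature.MathematicalPhysics.QuantumFieldTheory.Balaban1983to89.TorusGeometry
import HarnessLib

/-!
# Crux stmt-QuantumFields-19936 `HistoryTailL` — S-ALIGN brick C: THE COARSE CELLS OF THE FINE TORUS
# (cell corner `z₀ = blockOf (x − h𝟙)`, cell coordinates `t_k = (x_k − h) mod L`, blocks met `blockOf x = z₀ + [t ≥ h+1]`, one fine step)

Cell `ym3-torus` (rung R3 = YM₃ on T³ — a RUNG, NOT the Clay problem), width seat `ym-ust-19936-w3` gen 12, `--supports stmt-QuantumFields-19936 --as helper`.
Summons w2 g11 02:42:44Z «w3 g12: S-ALIGN».  The smoothing gauge interpolates multilinearly over the COARSE CELLS — the cubes of side `L` whose `2^d`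
corners are block centres `emb z`.  With `h = (L−1)∕2` and `s := x − h𝟙` (so `x = s + h𝟙`), the cell of `x` has lower corner `z₀ = blockOf s`, cell
coordinates `t_k = (s_k).val mod L ∈ [0, L)`, and THIS FILE proves, def-free and in the label arithmetic of `Setup` (`blockOf` = integer division,
`emb n = nL + h`; standing range `j + 1 ≤ m + K`):
* `self_eq_emb_blockOf_add` — `x_k = emb(z₀)_k + t_k` (the cell contains `x`);
* ★ `blockOf_add_half_eq` — `blockOf x = z₀ + 𝟙[t ≥ h+1]` coordinatewise (the `2^d` blocks a cell meets are its corners);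
* `blockOf_emb_sub_half`, `val_emb_sub_half_mod` — a centre `emb y` is the `t = 0` corner of its own cell `z₀ = y`;
* ★ `cell_shift_of_lt` ∕ `cell_shift_of_eq` — one fine step `+e_μ`: inside the cell (`t_μ + 1 < L`: same `z₀`, `t_μ ↦ t_μ + 1`) or into the next
  cell (`t_μ + 1 = L`: `z₀ ↦ z₀ + e_μ`, `t_μ ↦ 0`);
* `interp_face_shift` — the multilinear interpolant read from the next cell at `t_μ = 0` IS the old cell's at `t_μ = L` (exact continuity).
-/

noncomputable section

open scoped BigOperators

namespace Summit.QuantumFields.YangMills.Theorems.PoincareLipschitzHierAlignCell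

open Literature.MathematicalPhysics.QuantumFieldTheory.Balaban1983to89

variable {P : Params} {j : ℕ}

/-! ## §1 Label arithmetic -/

/-- `L = 2h + 1` with `h = (L−1)∕2` (`L` odd). [folklore] -/
theorem two_mul_half_add_one : 2 * ((P.L - 1) / 2) + 1 = P.L := by
  obtain ⟨m, hm⟩ := P.hL.1
  omega

/-- `h < sitesPerDir j` in the standing range. [folklore] -/
theorem half_lt_sitesPerDir (hj : j + 1 ≤ P.m + P.K) : (P.L - 1) / 2 < P.sitesPerDir j := by
  rw [P.sitesPerDir_eq_mul_succ hj]
  have h1 : 1 ≤ P.sitesPerDir (j + 1) := (P.one_lt_sitesPerDir (j + 1)).le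
  have hlt : (P.L - 1) / 2 < P.L := by have := P.hL.2; omega
  calc (P.L - 1) / 2 < P.L := hlt
    _ = 1 * P.L := (one_mul _).symm
    _ ≤ P.sitesPerDir (j + 1) * P.L := Nat.mul_le_mul_right _ h1

/-- The label of `h𝟙` is `h`. [folklore] -/
theorem val_half (hj : j + 1 ≤ P.m + P.K) :
    ((((P.L - 1) / 2 : ℕ) : ZMod (P.sitesPerDir j))).val = (P.L - 1) / 2 :=
  ZMod.val_natCast_of_lt (half_lt_sitesPerDir hj)

/-- `s.val ∕ L < sitesPerDir (j+1)`. [folklore] -/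
theorem val_div_lt (hj : j + 1 ≤ P.m + P.K) (s : ZMod (P.sitesPerDir j)) : s.val / P.L < P.sitesPerDir (j + 1) := by
  rw [Nat.div_lt_iff_lt_mul P.L_pos, ← P.sitesPerDir_eq_mul_succ hj]
  exact ZMod.val_lt s

/-! ## §2 The cell of a fine site -/

/-- ★ `x_k = emb(z₀)_k + t_k` for `x = s + h𝟙`, `z₀ = blockOf s`, `t_k = s_k.val mod L`. [folklore] -/
theorem self_eq_emb_blockOf_add (hj : j + 1 ≤ P.m + P.K) (s : Site P j) (k : Fin P.d) :
    s k + (((P.L - 1) / 2 : ℕ) : ZMod (P.sitesPerDir j)) =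
      emb (blockOf s) k + ((((s k).val % P.L : ℕ)) : ZMod (P.sitesPerDir j)) := by
  have hv : ((blockOf s) k).val = (s k).val / P.L := Site.val_blockOf hj s k
  simp only [emb]
  rw [hv]
  have e : (s k).val / P.L * P.L + (P.L - 1) / 2 + (s k).val % P.L = (s k).val + (P.L - 1) / 2 := by
    have := Nat.div_add_mod' (s k).val P.L
    omega
  rw [← Nat.cast_add, e, Nat.cast_add, ZMod.natCast_zmod_val]

/-- ★★ **THE BLOCKS A CELL MEETS ARE ITS CORNERS**: `blockOf (s + h𝟙)_k = (blockOf s)_k + 𝟙[h + 1 ≤ t_k]`. [folklore] -/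
theorem blockOf_add_half_eq (hj : j + 1 ≤ P.m + P.K) (s : Site P j) (k : Fin P.d) :
    blockOf (fun i => s i + (((P.L - 1) / 2 : ℕ) : ZMod (P.sitesPerDir j))) k =
      blockOf s k + (if (P.L - 1) / 2 + 1 ≤ (s k).val % P.L then 1 else 0) := by
  have hL := P.hL.2
  have h2 := two_mul_half_add_one (P := P)
  have hN := P.sitesPerDir_eq_mul_succ hj
  set q := (s k).val / P.L with hq
  set r := (s k).val % P.L with hr
  have hqr : (s k).val = q * P.L + r := by rw [hq, hr]; have := Nat.div_add_mod' (s k).val P.L; omega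
  have hrL : r < P.L := Nat.mod_lt _ P.L_pos
  have hqN : q < P.sitesPerDir (j + 1) := val_div_lt hj (s k)
  have hvalh := val_half hj (P := P)
  -- the label of `x_k`
  change ((((s k + (((P.L - 1) / 2 : ℕ) : ZMod (P.sitesPerDir j))).val / P.L : ℕ)) : ZMod (P.sitesPerDir (j + 1))) =
    ((((s k).val / P.L : ℕ)) : ZMod (P.sitesPerDir (j + 1))) + _
  rw [← hq]
  by_cases hwrap : (s k).val + (P.L - 1) / 2 < P.sitesPerDir j
  · -- no wrap-around
    have hv : (s k + (((P.L - 1) / 2 : ℕ) : ZMod (P.sitesPerDir j))).val = q * P.L + ((P.L - 1) / 2 + r) := by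
      rw [ZMod.val_add_of_lt (by rw [hvalh]; exact hwrap), hvalh, hqr]; ring
    rw [hv]
    by_cases hface : (P.L - 1) / 2 + 1 ≤ r
    · rw [if_pos hface]
      have : (q * P.L + ((P.L - 1) / 2 + r)) / P.L = q + 1 := by
        rw [show q * P.L + ((P.L - 1) / 2 + r) = (q + 1) * P.L + ((P.L - 1) / 2 + r - P.L) by
          rw [Nat.add_mul, one_mul]; omega]
        rw [Nat.add_comm, Nat.add_mul_div_right _ _ P.L_pos, Nat.div_eq_of_lt (by omega), zero_add]
      rw [this]; push_cast; ring
    · rw [if_neg hface]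
      have : (q * P.L + ((P.L - 1) / 2 + r)) / P.L = q := by
        rw [Nat.add_comm, Nat.add_mul_div_right _ _ P.L_pos, Nat.div_eq_of_lt (by omega), zero_add]
      rw [this, add_zero]
  · -- wrap-around: `q = N' − 1` and the face is crossed
    push Not at hwrap
    have hq' : q + 1 = P.sitesPerDir (j + 1) := by
      by_contra hne
      have hq2 : q + 2 ≤ P.sitesPerDir (j + 1) := by omega
      have : (q + 2) * P.L ≤ P.sitesPerDir (j + 1) * P.L := Nat.mul_le_mul_right _ hq2
      rw [← hN] at this
      nlinarith
    have hM : P.sitesPerDir j = q * P.L + P.L := by rw [hN, ← hq']; ring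
    have hface : (P.L - 1) / 2 + 1 ≤ r := by
      by_contra hlt
      push Not at hlt
      have : (s k).val + (P.L - 1) / 2 < q * P.L + P.L := by
        rw [hqr]; omega
      omega
    rw [if_pos hface]
    have hv : (s k + (((P.L - 1) / 2 : ℕ) : ZMod (P.sitesPerDir j))).val = r + (P.L - 1) / 2 - P.L := by
      have h1 := ZMod.val_add_val_of_le (by rw [hvalh]; exact hwrap :
        P.sitesPerDir j ≤ (s k).val + ((((P.L - 1) / 2 : ℕ) : ZMod (P.sitesPerDir j))).val)
      rw [hvalh, hqr] at h1
      have h4 : (s k + (((P.L - 1) / 2 : ℕ) : ZMod (P.sitesPerDir j))).val + P.L = r + (P.L - 1) / 2 := by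
        linarith
      omega
    rw [hv, Nat.div_eq_of_lt (by omega)]
    have : ((q : ℕ) : ZMod (P.sitesPerDir (j + 1))) + 1 = 0 := by
      rw [← Nat.cast_add_one, hq', ZMod.natCast_self]
    rw [this]; simp

/-- A centre `emb y` is the `t = 0` corner of ITS OWN cell: `blockOf (emb y − h𝟙) = y`. [folklore] -/
theorem blockOf_emb_sub_half (hj : j + 1 ≤ P.m + P.K) (y : Site P (j + 1)) :
    blockOf (fun i => emb y i - (((P.L - 1) / 2 : ℕ) : ZMod (P.sitesPerDir j))) = y := by
  funext k
  apply ZMod.val_injective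
  rw [Site.val_blockOf hj]
  have e : emb y k - (((P.L - 1) / 2 : ℕ) : ZMod (P.sitesPerDir j)) = ((((y k).val * P.L : ℕ)) : ZMod (P.sitesPerDir j)) := by
    simp only [emb]; push_cast; ring
  have hlt : (y k).val * P.L < P.sitesPerDir j := by
    rw [P.sitesPerDir_eq_mul_succ hj]
    exact Nat.mul_lt_mul_of_pos_right (ZMod.val_lt _) P.L_pos
  change (((fun i => emb y i - (((P.L - 1) / 2 : ℕ) : ZMod (P.sitesPerDir j))) k).val / P.L) = _
  simp only []
  rw [e, ZMod.val_natCast_of_lt hlt, Nat.mul_div_cancel _ P.L_pos]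

/-- … and its cell coordinates vanish: `(emb y − h𝟙)_k.val mod L = 0`. [folklore] -/
theorem val_emb_sub_half_mod (hj : j + 1 ≤ P.m + P.K) (y : Site P (j + 1)) (k : Fin P.d) :
    (emb y k - (((P.L - 1) / 2 : ℕ) : ZMod (P.sitesPerDir j))).val % P.L = 0 := by
  have e : emb y k - (((P.L - 1) / 2 : ℕ) : ZMod (P.sitesPerDir j)) = ((((y k).val * P.L : ℕ)) : ZMod (P.sitesPerDir j)) := by
    simp only [emb]; push_cast; ring
  have hlt : (y k).val * P.L < P.sitesPerDir j := by
    rw [P.sitesPerDir_eq_mul_succ hj]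
    exact Nat.mul_lt_mul_of_pos_right (ZMod.val_lt _) P.L_pos
  rw [e, ZMod.val_natCast_of_lt hlt, Nat.mul_mod_left]

/-! ## §3 One fine step -/

/-- Off the direction of the step nothing changes. [folklore] -/
theorem shift_apply_of_ne (s : Site P j) {μ k : Fin P.d} (hk : k ≠ μ) : Site.shift s μ k = s k := by
  rw [Site.shift, Function.update_of_ne hk]

/-- In the direction of the step the label goes up by one. [folklore] -/
theorem shift_apply_self (s : Site P j) (μ : Fin P.d) : Site.shift s μ μ = s μ + 1 := by
  rw [Site.shift, Function.update_self]

/-- ★ **A STEP INSIDE THE CELL** (`t_μ + 1 < L`): same cell corner, `t_μ ↦ t_μ + 1`. [folklore] -/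
theorem cell_shift_of_lt (hj : j + 1 ≤ P.m + P.K) (s : Site P j) (μ : Fin P.d) (hr : (s μ).val % P.L + 1 < P.L) :
    blockOf (Site.shift s μ) = blockOf s ∧ ((Site.shift s μ) μ).val % P.L = (s μ).val % P.L + 1 := by
  have hN := P.sitesPerDir_eq_mul_succ hj
  set q := (s μ).val / P.L with hq
  set r := (s μ).val % P.L with hr'
  have hqr : (s μ).val = q * P.L + r := by rw [hq, hr']; have := Nat.div_add_mod' (s μ).val P.L; omega
  have hqN : q < P.sitesPerDir (j + 1) := val_div_lt hj (s μ)
  have hv : ((Site.shift s μ) μ).val = q * P.L + (r + 1) := by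
    rw [shift_apply_self]
    have h1 : (1 : ZMod (P.sitesPerDir j)).val = 1 := ZMod.val_one'' (P.one_lt_sitesPerDir j).ne'
    rw [ZMod.val_add_of_lt (by
      rw [h1, hqr, hN]
      have : (q + 1) * P.L ≤ P.sitesPerDir (j + 1) * P.L := Nat.mul_le_mul_right _ hqN
      nlinarith), h1, hqr]; ring
  refine ⟨?_, ?_⟩
  · funext k
    by_cases hk : k = μ
    · subst hk
      apply ZMod.val_injective
      rw [Site.val_blockOf hj, Site.val_blockOf hj, hv, ← hq, Nat.add_comm, Nat.add_mul_div_right _ _ P.L_pos,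
        Nat.div_eq_of_lt hr, zero_add]
    · simp only [blockOf, shift_apply_of_ne s hk]
  · rw [hv, Nat.add_comm, Nat.add_mul_mod_self_right, Nat.mod_eq_of_lt hr]

/-- ★ **A STEP INTO THE NEXT CELL** (`t_μ + 1 = L`): the cell corner moves by `+e_μ` and `t_μ ↦ 0`. [folklore] -/
theorem cell_shift_of_eq (hj : j + 1 ≤ P.m + P.K) (s : Site P j) (μ : Fin P.d) (hr : (s μ).val % P.L + 1 = P.L) :
    blockOf (Site.shift s μ) = Site.shift (blockOf s) μ ∧ ((Site.shift s μ) μ).val % P.L = 0 := by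
  have hN := P.sitesPerDir_eq_mul_succ hj
  set q := (s μ).val / P.L with hq
  set r := (s μ).val % P.L with hr'
  have hqr : (s μ).val = q * P.L + r := by rw [hq, hr']; have := Nat.div_add_mod' (s μ).val P.L; omega
  have hqN : q < P.sitesPerDir (j + 1) := val_div_lt hj (s μ)
  -- the new label is the cast of `(q+1)·L`
  have hcast : (Site.shift s μ) μ = ((((q + 1) * P.L : ℕ)) : ZMod (P.sitesPerDir j)) := by
    have e : q * P.L + r + 1 = (q + 1) * P.L := by rw [Nat.add_mul, one_mul, ← hr]; ring
    rw [shift_apply_self, ← ZMod.natCast_zmod_val (s μ), hqr, ← e]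
    push_cast; ring
  have hvmod : (((Site.shift s μ) μ).val) % P.L = 0 := by
    rw [hcast, ZMod.val_natCast, hN, Nat.mod_mul_left_mod, Nat.mul_mod_left]
  refine ⟨?_, hvmod⟩
  funext k
  by_cases hk : k = μ
  · subst hk
    rw [shift_apply_self]
    change ((((Site.shift s k k).val / P.L : ℕ)) : ZMod (P.sitesPerDir (j + 1))) =
      ((((s k).val / P.L : ℕ)) : ZMod (P.sitesPerDir (j + 1))) + 1
    rw [← hq, hcast, ZMod.val_natCast, hN]
    by_cases hlt : (q + 1) * P.L < P.sitesPerDir (j + 1) * P.L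
    · rw [Nat.mod_eq_of_lt hlt, Nat.mul_div_cancel _ P.L_pos]; push_cast; ring
    · have hq' : q + 1 = P.sitesPerDir (j + 1) := by
        have : (q + 1) * P.L ≤ P.sitesPerDir (j + 1) * P.L := Nat.mul_le_mul_right _ hqN
        have h2 : P.sitesPerDir (j + 1) * P.L ≤ (q + 1) * P.L := not_lt.1 hlt
        have := le_antisymm this h2
        exact Nat.eq_of_mul_eq_mul_right P.L_pos this
      rw [hq', Nat.mod_self, Nat.zero_div]
      have : ((q : ℕ) : ZMod (P.sitesPerDir (j + 1))) + 1 = 0 := by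
        rw [← Nat.cast_add_one, hq', ZMod.natCast_self]
      rw [this]; simp
  · simp only [blockOf, Site.shift, Function.update_of_ne hk]

/-! ## §4 Exact continuity of the interpolant across a cell face -/

/-- ★ **FACE CONTINUITY**: reading the multilinear interpolant from the NEXT cell at `t_μ = 0` (corner data `Λ'`) gives the OLD cell's
value at `t_μ = L` (corner data `Λ`), as soon as `Λ' ε = Λ (ε[μ ↦ 1])` on the shared face `ε_μ = 0`. [folklore] -/
theorem interp_face_shift {d : ℕ} {E : Type*} [AddCommGroup E] [Module ℝ E] (L : ℕ) (hL : 0 < L) (t : Fin d → ℕ) (μ : Fin d)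
    (Λ Λ' : (Fin d → Bool) → E) (hface : ∀ ε : Fin d → Bool, ε μ = false → Λ' ε = Λ (Function.update ε μ true)) :
    ∑ ε : Fin d → Bool, (∏ k, (if ε k then (((Function.update t μ 0 k : ℕ) : ℝ) / L)
        else (1 - ((Function.update t μ 0 k : ℕ) : ℝ) / L))) • Λ' ε =
      ∑ ε : Fin d → Bool, (∏ k, (if ε k then (((Function.update t μ L k : ℕ) : ℝ) / L)
        else (1 - ((Function.update t μ L k : ℕ) : ℝ) / L))) • Λ ε := by
  have hL' : (L : ℝ) ≠ 0 := by exact_mod_cast hL.ne'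
  -- kill the `ε μ = true` terms on the left and the `ε μ = false` terms on the right
  rw [← Finset.sum_filter_add_sum_filter_not Finset.univ (fun ε : Fin d → Bool => ε μ = false),
    ← Finset.sum_filter_add_sum_filter_not Finset.univ (fun ε : Fin d → Bool => ε μ = false) (f := fun ε =>
      (∏ k, (if ε k then (((Function.update t μ L k : ℕ) : ℝ) / L) else (1 - ((Function.update t μ L k : ℕ) : ℝ) / L))) • Λ ε)]
  have hzero1 : ∑ ε ∈ Finset.univ.filter (fun ε : Fin d → Bool => ¬ ε μ = false),
      (∏ k, (if ε k then (((Function.update t μ 0 k : ℕ) : ℝ) / L) else (1 - ((Function.update t μ 0 k : ℕ) : ℝ) / L))) • Λ' ε = 0 := by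
    refine Finset.sum_eq_zero fun ε hε => ?_
    simp only [Finset.mem_filter, Finset.mem_univ, true_and, Bool.not_eq_false] at hε
    have : (∏ k, (if ε k then (((Function.update t μ 0 k : ℕ) : ℝ) / L) else (1 - ((Function.update t μ 0 k : ℕ) : ℝ) / L))) = 0 := by
      apply Finset.prod_eq_zero (Finset.mem_univ μ)
      simp [hε]
    rw [this, zero_smul]
  have hzero2 : ∑ ε ∈ Finset.univ.filter (fun ε : Fin d → Bool => ε μ = false),
      (∏ k, (if ε k then (((Function.update t μ L k : ℕ) : ℝ) / L) else (1 - ((Function.update t μ L k : ℕ) : ℝ) / L))) • Λ ε = 0 := by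
    refine Finset.sum_eq_zero fun ε hε => ?_
    simp only [Finset.mem_filter, Finset.mem_univ, true_and] at hε
    have : (∏ k, (if ε k then (((Function.update t μ L k : ℕ) : ℝ) / L) else (1 - ((Function.update t μ L k : ℕ) : ℝ) / L))) = 0 := by
      apply Finset.prod_eq_zero (Finset.mem_univ μ)
      simp [hε, hL']
    rw [this, zero_smul]
  rw [hzero1, hzero2, add_zero, zero_add]
  -- re-index the right by `ε ↦ update ε μ true`
  refine Finset.sum_bij' (fun ε _ => Function.update ε μ true) (fun ε _ => Function.update ε μ false) ?_ ?_ ?_ ?_ ?_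
  · intro ε _; simp
  · intro ε _; simp
  · intro ε hε
    simp only [Finset.mem_filter, Finset.mem_univ, true_and] at hε
    funext k; by_cases hk : k = μ
    · subst hk; simp [hε]
    · simp [Function.update_of_ne hk]
  · intro ε hε
    simp only [Finset.mem_filter, Finset.mem_univ, true_and, Bool.not_eq_false] at hε
    funext k; by_cases hk : k = μ
    · subst hk; simp [hε]
    · simp [Function.update_of_ne hk]
  · intro ε hε
    simp only [Finset.mem_filter, Finset.mem_univ, true_and] at hε
    rw [hface ε hε]
    congr 1
    rw [← Finset.mul_prod_erase Finset.univ _ (Finset.mem_univ μ), ← Finset.mul_prod_erase Finset.univ _ (Finset.mem_univ μ)]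
    have e1 : ∏ k ∈ Finset.univ.erase μ,
        (if ε k then (((Function.update t μ 0 k : ℕ) : ℝ) / L) else (1 - ((Function.update t μ 0 k : ℕ) : ℝ) / L)) =
        ∏ k ∈ Finset.univ.erase μ, (if ε k then ((t k : ℝ) / L) else (1 - (t k : ℝ) / L)) :=
      Finset.prod_congr rfl fun k hk => by rw [Function.update_of_ne (Finset.ne_of_mem_erase hk)]
    have e2 : ∏ k ∈ Finset.univ.erase μ,
        (if Function.update ε μ true k then (((Function.update t μ L k : ℕ) : ℝ) / L)
          else (1 - ((Function.update t μ L k : ℕ) : ℝ) / L)) =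
        ∏ k ∈ Finset.univ.erase μ, (if ε k then ((t k : ℝ) / L) else (1 - (t k : ℝ) / L)) :=
      Finset.prod_congr rfl fun k hk => by
        rw [Function.update_of_ne (Finset.ne_of_mem_erase hk), Function.update_of_ne (Finset.ne_of_mem_erase hk)]
    rw [e1, e2]
    simp [hε, hL']

end Summit.QuantumFields.YangMills.Theorems.PoincareLipschitzHierAlignCell

end
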